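/-
PORT (cell pub-hodgecm2, COR-CM = stage 2 of the Hodge ladder): tree copy of the pub-hodgecm package module
`HodgeCM/Geometry/Statements.lean` (package root `run/shared/lean/pub/pub-hodgecm/lean/HodgeCMPerL/`; file md5 d7478b5ec7df13c6dede103cbdeb18cd, 151 lines, as landed
in the package on 2026-08-20).  MECHANICAL REWRITES ONLY (script `work/port.py` of seat planner-pub-hodgecm2-lead-0):
(R1) the package Origin/Copyright comment blocks are replaced by this header; (R2) imports: `HodgeCM.Vendored.H21.<M>` ->
`Literature.<M>` (the vendored modules are byte-identical copies of the tree modules, DIFF-CERT of pub-hodgecm RUN 55),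
`HodgeCM.Vendored.{WeilTypeCM,Hermitian,HodgeStructure}` -> their tree originals, `HodgeCM.<A>.<B>` -> `Summits.HodgeConjecture.CorCM.<A>.<B>` (mirrored paths under `Summits/HodgeConjecture/CorCM/`);
(R3) `namespace HodgeCM` -> `namespace Summit.HodgeConjecture.CorCM` (docstring references `HodgeCM.<Module>` still NAME PACKAGE modules);
(R5) `import HarnessLib`.  Declaration bodies, statements and docstrings are otherwise VERBATIM.
-/
import Summits.HodgeConjecture.CorCM.Geometry.Universe
import HarnessLib

/-!
# The exact statements: PerL, PerL Thm 4.4, the period theorem over `F` (rfwf Thm 4.1),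
# the surface criterion (rfwf Prop 2.2), `W^{RK4}` (rfwf Thm 1.3), the reductions, COR-CM

All declarations of this file are `Prop`-valued DEFINITIONS over a geometric universe `U`
(`HodgeCM.Geometry.Universe`); nothing is asserted. Verbatim sources (follow-ups doc §B.1):

* `PerL`        — PerL v5 (d912a121), node statement `W_per^L` as minted (∃ (V₃,h), ∃ Γ, …).
* `PerL44`      — PerL v5 Thm 4.4 as proved (∀ (V₃,h), ∃ Γ, …), which "proves W_per^L".
* `PeriodThmF`  — rfwf v3 (a9f5cf86) Thm 4.1 `t:per`, SPECIALISED to admissible `ι₁` (rfwf allows any base embedding; enough for `W_RK4`).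
* `SurfaceCriterion` — rfwf Prop 2.2 `p:surf`, admissible `ι₁`, target `A_{Θ_i}` (rfwf: the simple `B_i`) — stronger, PROVED in-model.
* `W_RK4`       — rfwf Thm 1.3 (`W^{RK4}_F` for all F and all faces).
* `FaceReduction` — QW8 Thm 2.5 + Pohlmann + `l:allg` + the ā-bridge ((ii)–(iv) of the COR-CM table).
* `Lemma81`     — rfwf v3 Lemma 8.2 `l:reduce` (tex ll. 418–425; decl name historical) = [MilneLP] (i): reduction to products of `A_Φ` over one Galois CM field.
* `HC_CM`       — COR-CM (rfwf v3 Cor. 8.3 `c:cm`, tex l. 447, first clause), defined in `Universe.lean`.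
-/

noncomputable section

namespace Summit.HodgeConjecture.CorCM

open Literature.AlgebraicGeometry.Motives (CMType)

namespace Universe

variable (U : Universe)

/-- The common CONCLUSION SHAPE of PerL Thm 4.4 and rfwf Thm 4.1. Data: the surface field `L` with
`ι₁` and `(V₃,h)`; the field `K` of the four target CM abelian varieties `B_i = A_{(K, Ψ i)}` and the
eigen-embedding `σ : K → ℂ` of the one-forms. Statement: there are a torsion-free congruence level `Γ`,
morphisms `F_i : P_Γ → B_i` and holomorphic `σ`-eigen one-forms `α_i` on `B_i` with
`∫_{P_Γ} F₁^*α₁ ∧ F₂^*α₂ ∧ \overline{F₃^*α₃ ∧ F₄^*α₄} ≠ 0`. [folklore] -/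
def PeriodNV {L : CMField} (ι₁ : L →+* ℂ) (V : HermSpace3 L ι₁) (K : CMField)
    (Ψ : Fin 4 → CMType K) (σ : K →+* ℂ) : Prop :=
  ∃ (Γ : Level V) (F : (i : Fin 4) → U.Mor (U.pms L ι₁ V Γ) (U.cmAV K (Ψ i)))
    (α : (i : Fin 4) → U.CohC (U.cmAV K (Ψ i)) 1),
    (∀ i, α i ∈ U.alphaLine K (Ψ i) σ) ∧
      U.period (U.pms L ι₁ V Γ) (fun i => U.pullC (F i) 1 (α i)) ≠ 0

/-- **PerL = `W_per^L` verbatim** (PerL v5, node statement; follow-ups §B.1). `K` sextic CM with frame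
`φ₁, φ₂, φ₃` of its three places; `L = K̃` its Galois closure with `[L:ℚ] ∈ {24, 48}`, `j : K ↪ L` and
`ι₁ : L ↪ ℂ` with `ι₁|_K = φ₁`; `t¹,…,t⁴` the four CM types of `K` with sign table `perlSign`. THEN: there
exist a hermitian space `(V₃,h)/L` of signature `(2,1)` at `ι₁`, `(3,0)` elsewhere, a torsion-free
congruence `Γ ⊂ U(V₃,h)(L₀)`, morphisms `F_i : P_Γ → B_{tⁱ}` and `φ₁`-eigendifferentials `α_i` with
`∫_{P_Γ} F₁^*α₁ ∧ F₂^*α₂ ∧ \overline{F₃^*α₃ ∧ F₄^*α₄} ≠ 0`. -/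
@[conjecture]
def PerL : Prop :=
  ∀ (K L : CMField) (j : K →+* L), IsNormalClosure ℚ K L →
    Module.finrank ℚ K = 6 → (Module.finrank ℚ L = 24 ∨ Module.finrank ℚ L = 48) →
    ∀ (φ : Fin 3 → (K →+* ℂ)), IsFrame φ →
    ∀ (ι₁ : L →+* ℂ), ι₁.comp j = φ 0 →
    ∀ (t : Fin 4 → CMType K), IsPerLTypes φ t →
      ∃ V : HermSpace3 L ι₁, U.PeriodNV ι₁ V K t (φ 0)

/-- **PerL Thm 4.4 as proved** (`thm:main`, tex l. 685): the same with "for EVERY `(V₃, h)` there is a level `Γ` …"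
(follow-ups §B.1: "Thm 4.4 as proved has ∀(V₃,h) ∃Γ, hence proves W_per^L"). -/
@[conjecture]
def PerL44 : Prop :=
  ∀ (K L : CMField) (j : K →+* L), IsNormalClosure ℚ K L →
    Module.finrank ℚ K = 6 → (Module.finrank ℚ L = 24 ∨ Module.finrank ℚ L = 48) →
    ∀ (φ : Fin 3 → (K →+* ℂ)), IsFrame φ →
    ∀ (ι₁ : L →+* ℂ), ι₁.comp j = φ 0 →
    ∀ (t : Fin 4 → CMType K), IsPerLTypes φ t →
      ∀ V : HermSpace3 L ι₁, U.PeriodNV ι₁ V K t (φ 0)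

/-- **The period theorem over `F`**, ADMISSIBLE SPECIALISATION of rfwf v3 Thm 4.1 `t:per` (tex ll. 209–213; rfwf allows any base embedding `1 ∈ G` with renumbered corners — this weaker form suffices for `W_RK4` via `AdmissibleExists`; = PerL Thm 4.4 transposed, §4.2):
`F` a Galois CM field with `2g = [F:ℚ] ≥ 6`, `(Φ; π, π′)` any rank-four face, `ι₁` an admissible
embedding (`ι₁ ∈ Φ`, off `π, π′`), `(V₃,h)/F` hermitian of signature `(2,1)` at `ι₁`, `(3,0)` elsewhere:
there are a torsion-free congruence `Γ ⊂ U(V₃,h)(F₀)`, morphisms `F_i : P_Γ → B_i = A_{Ψ_i}` and the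
`ι₁`-eigen holomorphic one-forms `α_i` with nonzero period. -/
@[conjecture]
def PeriodThmF : Prop :=
  ∀ (F : CMField), IsGalois ℚ F → 6 ≤ Module.finrank ℚ F →
    ∀ (f : Face F) (ι₁ : F →+* ℂ), f.Admissible ι₁ →
    ∀ V : HermSpace3 F ι₁, U.PeriodNV ι₁ V F f.psi ι₁

/-- **The surface criterion** (rfwf v3 Prop 2.2 `p:surf`, tex ll. 101–108): for a smooth projective SURFACE `S`,
morphisms `F_i : S → B_i = A_{Ψ_i}` and `ι₁`-eigen holomorphic one-forms `α_i`, non-vanishing of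
`∫_S F₁^*α₁ ∧ F₂^*α₂ ∧ \overline{F₃^*α₃ ∧ F₄^*α₄}` implies that `W_F(P)` consists of algebraic classes
("Lefschetz (1,1) on S plus F-eigencharacter bookkeeping"; independent of PerL). -/
@[conjecture]
def SurfaceCriterion : Prop :=
  ∀ (F : CMField), IsGalois ℚ F → ∀ (f : Face F) (ι₁ : F →+* ℂ), f.Admissible ι₁ →
    ∀ (S : U.Var), U.dim S = 2 →
    ∀ (Fm : (i : Fin 4) → U.Mor S (U.cmAV F (f.psi i)))
      (α : (i : Fin 4) → U.CohC (U.cmAV F (f.psi i)) 1),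
      (∀ i, α i ∈ U.alphaLine F (f.psi i) ι₁) →
      U.period S (fun i => U.pullC (Fm i) 1 (α i)) ≠ 0 →
      U.WeilFaceAlgebraic F f

/-- **`W^{RK4}`** (rfwf v3 Thm 1.3 `t:main`, tex ll. 70–73): for every Galois CM field `F` with `2g ≥ 6` and every
rank-four face `(Φ; π, π′)`, the Weil line `W_F(P) ⊂ H⁴(P, ℚ)` of `P = ∏ A_{Φᵢ}` consists of algebraic
classes. -/
@[conjecture]
def W_RK4 : Prop :=
  ∀ (F : CMField), IsGalois ℚ F → 6 ≤ Module.finrank ℚ F → ∀ f : Face F, U.WeilFaceAlgebraic F f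

/-! ### Products of CM abelian varieties over one Galois CM field, and the two reductions -/

/-- `n+1`-fold product of varieties (left-nested). [folklore] -/
def prodFin : (n : ℕ) → (Fin (n + 1) → U.Var) → U.Var
  | 0, X => X 0
  | n + 1, X => U.prod (prodFin n (fun i => X i.castSucc)) (X (Fin.last (n + 1)))

/-- `A′ = ∏_j A_{(F, Θ_j)}` for a finite family of CM types of ONE Galois CM field `F`
(rfwf v3 Lemma 8.2's target shape; multiplicities = repetitions in `Θ`). [folklore] -/
def cmProd (F : CMField) {n : ℕ} (Θ : Fin (n + 1) → CMType F) : U.Var :=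
  U.prodFin n (fun j => U.cmAV F (Θ j))

/-- **Face reduction** = rows (ii)–(iv) of the COR-CM table (follow-ups §B.1): for a Galois CM field
`F` with `2g ≥ 6`, algebraicity of ALL rank-four face lines `W_F(P(f))` implies the Hodge conjecture for
every product `∏_j A_{(F,Θ_j)}`. Print content: Pohlmann 1968 (Hodge ring of `A′` spanned by Hodge
monomials; [QW8] L2.2), the lattice statement `l:allg` ("face relations generate the relation lattice
for ALL `g ≥ 3`" — machine-checked: `HodgeCM.Prior.AllgGroup.gfaces_generate`), [QW8] Thm 2.5
(sufficiency of `W^{RK4}`; combinatorial core machine-checked: `HodgeCM.Prior.Qw8Sufficiency`), and the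
ā-bridge of [QW8] §3. Print precedent for the sum-of-types mechanism: Hazama, Publ. RIMS 39 (2003) 625–655,
Thm 8.3; Milne arXiv:0709.3040 Thm 8.5; André 1992. -/
@[conjecture]
def FaceReduction : Prop :=
  ∀ (F : CMField), IsGalois ℚ F → 6 ≤ Module.finrank ℚ F →
    (∀ f : Face F, U.WeilFaceAlgebraic F f) →
    ∀ (n : ℕ) (Θ : Fin (n + 1) → CMType F), U.HC (U.cmProd F Θ)

/-- **rfwf v3 Lemma 8.2** `l:reduce` (tex ll. 418–425), global form (decl name `Lemma81` historical; = [MilneLP] (i); print: André 1992 §1, Milne arXiv:2010.08857 §1, Shimura–Taniyama):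
the Hodge conjecture for all CM abelian varieties follows from the Hodge conjecture for the products
`∏_j A_{(F,Θ_j)}` over Galois CM fields `F` of degree `≥ 6` ("A CM ⇒ A^m ~ ∏ A_{Φ_j}^{n_j} over a common
Galois CM field F; HC(A) ⟸ HC(A′) for A′ → A^m dominant"; the degree bound by enlarging `F`). -/
@[conjecture]
def Lemma81 : Prop :=
  (∀ (F : CMField), IsGalois ℚ F → 6 ≤ Module.finrank ℚ F →
      ∀ (n : ℕ) (Θ : Fin (n + 1) → CMType F), U.HC (U.cmProd F Θ)) →
    U.HC_CM

/-! ### Auxiliary existence statements used by the assembly -/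

/-- **Landherr**: over every CM field `L` and for every `ι₁` there is a hermitian 3-space of signature
`(2,1)` at `ι₁` and `(3,0)` elsewhere (Landherr 1936; Scharlau, *Quadratic and Hermitian Forms*, Ch. 10). [folklore] -/
def LandherrExists : Prop := ∀ (L : CMField) (ι₁ : L →+* ℂ), Nonempty (HermSpace3 L ι₁)

/-- Picard modular surfaces are surfaces. [folklore] -/
def PmsDimTwo : Prop :=
  ∀ (L : CMField) (ι₁ : L →+* ℂ) (V : HermSpace3 L ι₁) (Γ : Level V), U.dim (U.pms L ι₁ V Γ) = 2

/-- This package's own normalisation (NOT rfwf Lemma 2.1 = `l:tetra`, the pair-sum identity): for `[F:ℚ] ≥ 6`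
every face admits an admissible embedding (`Φ` has `g ≥ 3` elements at distinct places, at most two of which are `π, π′`). [folklore] -/
def AdmissibleExists : Prop :=
  ∀ (F : CMField), 6 ≤ Module.finrank ℚ F → ∀ f : Face F, ∃ ι₁ : F →+* ℂ, f.Admissible ι₁

end Universe

end Summit.HodgeConjecture.CorCM

end
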